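import Summits.HodgeConjecture.HodgeConjecture.Theorems.DworkReflectionQuotientsGIOfFacts
import Literature.AlgebraicGeometry.HodgeTheory.DworkSexticPencilHolomorphicFrames

/-!
# Route `DworkReflectionQuotients`: crux `GenericInvariantHodgeClasses` (GI) modulo Griffiths' holomorphic
# Hodge frames (Voisin I Thm. 10.3) and the Carlson–Griffiths–Voisin climb (Voisin II Thm. 6.13)

Route `route-HodgeConjecture-DworkReflectionQuotients` (cell `hodge-nonav`; FRONTIER rung F-H1 — never summit
credit), item `stmt-HodgeConjecture-24129` `GenericInvariantHodgeClasses`. Prover seat `hodge-nonav-20241-p1`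
(g9). SUPPORT FILE (`--supports`; CONDITIONAL results): the `hol` input of
`genericInvariantHodgeClasses_of_facts` (file `DworkReflectionQuotientsGIOfFacts`) is a tree theorem modulo the
PRIMARY named fact `DworkSextic.Griffiths1968_dworkPencil_holomorphicHodgeFrames` (Voisin I Thm. 10.3 in frame
form along the pencil; `DworkSextic.Voisin2002_dworkPencil_hodgeFiltrationTwo_locus_dichotomy_of_holomorphicHodgeFrames`,
file `Literature/…/DworkSexticPencilHolomorphicFrames`), so the item's signature, the support
`GenericHodgeClassesFlat` and the rung leaf `DworkSexticHodge` follow from {frames, climb} (+ crux K1 for the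
last two). The route's residual print dependence: {Bini–Garbagnati 3.20 + KMM (K1's fact), Voisin I Thm. 10.3
along the pencil (frames), Voisin II Thm. 6.13 along the pencil (climb)}. Nothing here says HC, HC_CM or HC_AV
is proved; rung F-H1 not moved.

## References

* C. Voisin, *Hodge Theory and Complex Algebraic Geometry I* (2002), Thm. 10.3. [VoisinHodgeI2002]
* C. Voisin, *Hodge Theory and Complex Algebraic Geometry II* (2003), §5.3, Thm. 6.13, Thm. 6.24 (proof).
  [VoisinHodgeII2003]
-/

namespace Summit.HodgeConjecture.HodgeConjecture.Theorems

open Literature.AlgebraicGeometry.HodgeTheory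

/-- **`GenericInvariantHodgeClasses` (stmt-HodgeConjecture-24129), signature verbatim, from Griffiths'
holomorphic Hodge frames along the pencil and the Carlson–Griffiths–Voisin climb** (the dichotomy input is
derived from the frames by the identity theorem). CONDITIONAL; rung F-H1 not moved.
[cite: VoisinHodgeI2002, Thm. 10.3] [cite: VoisinHodgeII2003, Thm. 6.24 (proof)] -/
theorem genericInvariantHodgeClasses_of_frames_of_climb
    (hframes : DworkSextic.Griffiths1968_dworkPencil_holomorphicHodgeFrames)
    (hclimb : DworkSextic.Voisin2003_dworkPencil_invariantFlatSection_climb) :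
    ∃ S : Set ℂ, S.Countable ∧ ∀ ψ : ℂ, ψ ∉ S → ψ ^ 6 ≠ 1 → let F : MvPolynomial (Fin 6) ℂ := (∑ i, MvPolynomial.X i ^ 6) - MvPolynomial.C (6 * ψ) * ∏ i, MvPolynomial.X i; let X := Literature.AlgebraicGeometry.Motives.SmoothHypersurface.hypersurface F; let pt := Literature.AlgebraicGeometry.HodgeTheory.hypersurfacePoint (Literature.AlgebraicGeometry.Motives.SmoothHypersurface.hypersurfaceι F); ∀ c : Literature.AlgebraicGeometry.HodgeTheory.complexBetti X (2 * 2), Literature.AlgebraicGeometry.HodgeTheory.IsRationalClass c → Literature.AlgebraicGeometry.HodgeTheory.IsOfHodgeType 4 X (2 * 2) 2 2 c → (∀ a : Fin 6 → ℂ, (∀ i, a i ^ 6 = 1) → ∏ i, a i = 1 → ∀ g : C(Literature.AlgebraicGeometry.Motives.ComplexPoints X, Literature.AlgebraicGeometry.Motives.ComplexPoints X), (∀ x, ∃ t : ℂ, (pt (g x)).rep = t • (a * (pt x).rep)) → Literature.AlgebraicTopology.SingularHomology.singularCohomology.map ℂ ℂ g (2 * 2) c = c) → c ∈ Literature.AlgebraicGeometry.HodgeTheory.algebraicClasses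 X 2 :=
  genericInvariantHodgeClasses_of_facts
    (DworkSextic.Voisin2002_dworkPencil_hodgeFiltrationTwo_locus_dichotomy_of_holomorphicHodgeFrames hframes)
    hclimb

/-- **The rung leaf `DworkSexticHodge` BY NAME from crux K1, Griffiths' holomorphic frames and the climb.**
CONDITIONAL (K1 open — in tree modulo the Bini–Garbagnati fact; two named analytic facts); FRONTIER rung
F-H1, never summit credit. [cite: VoisinHodgeI2002, Thm. 10.3] [cite: VoisinHodgeII2003, Thm. 6.24 (proof)] -/
theorem dworkSexticHodge_of_reflectionQuotientDescent_of_frames_of_climb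
    (h1 : Summit.HodgeConjecture.HodgeConjecture.Theses.DworkReflectionQuotients.ReflectionQuotientDescent)
    (hframes : DworkSextic.Griffiths1968_dworkPencil_holomorphicHodgeFrames)
    (hclimb : DworkSextic.Voisin2003_dworkPencil_invariantFlatSection_climb) :
    Summit.HodgeConjecture.HodgeConjecture.Theses.DworkPrymHodge.DworkSexticHodge :=
  dworkSexticHodge_of_reflectionQuotientDescent_of_facts h1
    (DworkSextic.Voisin2002_dworkPencil_hodgeFiltrationTwo_locus_dichotomy_of_holomorphicHodgeFrames hframes)
    hclimb

/-- **The support `GenericHodgeClassesFlat` (stmt-HodgeConjecture-20243) BY NAME from crux K1, Griffiths'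
holomorphic frames and the climb.** CONDITIONAL; rung F-H1 not moved.
[cite: VoisinHodgeI2002, Thm. 10.3] [cite: VoisinHodgeII2003, Thm. 6.24 (proof)] -/
theorem genericHodgeClassesFlat_of_reflectionQuotientDescent_of_frames_of_climb
    (h1 : Summit.HodgeConjecture.HodgeConjecture.Theses.DworkReflectionQuotients.ReflectionQuotientDescent)
    (hframes : DworkSextic.Griffiths1968_dworkPencil_holomorphicHodgeFrames)
    (hclimb : DworkSextic.Voisin2003_dworkPencil_invariantFlatSection_climb) :
    Summit.HodgeConjecture.HodgeConjecture.Theses.DworkReflectionQuotients.GenericHodgeClassesFlat :=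
  genericHodgeClassesFlat_of_reflectionQuotientDescent_of_facts h1
    (DworkSextic.Voisin2002_dworkPencil_hodgeFiltrationTwo_locus_dichotomy_of_holomorphicHodgeFrames hframes)
    hclimb

end Summit.HodgeConjecture.HodgeConjecture.Theorems
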